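import Literature.NumberTheory.EllipticCurves.LocalWeilPairingDuality
import Literature.NumberTheory.EllipticCurves.LocalKummerSequenceSurjective
import HarnessLib

/-!
# Tate local duality for `E` at a finite place, from the local Euler characteristic count

Topic `NumberTheory/EllipticCurves`; namespace `Literature.NumberTheory.EllipticCurves`. Theorems only:
**no named fact is introduced** (D-0026).

Let `K` be a number field, `E = W` an elliptic curve over `K`, `n ≠ 0`, `v` a finite place,
`K_v = v.adicCompletion K`, `E(K_v)` Mathlib's group of `K_v`-points of `W⁄K_v`,
`𝓛_v = kummerLocalConditionAt W n K_v ≤ H¹(K_v, E[n])` the local Kummer condition (image of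
`E(K_v)/n`).  The tree proves (this unit's files `LocalPointsIntegersSubgroup`, `LocalKummerMap`,
`LocalKummerSequenceSurjective`, `LocalWeilPairingDuality`):
`#𝓛_v = #E(K_v)[n] · #(𝓞_v/n)` (Milne I Lemma 3.3), the exact sequence
`0 → 𝓛_v → H¹(K_v, E[n]) → H¹(K_v, E)[n] → 0`, and that `𝓛_v` is its own annihilator for the local
Weil cup product as soon as `#H¹(K_v, E[n]) ≤ (#𝓛_v)²`.  This file assembles them:

* `natCard_torsionBy_galoisCohomology_localGaloisModule_mul` (unconditional):
  `#H¹(K_v, E)[n] · (#E(K_v)[n] · #(𝓞_v/n)) = #H¹(K_v, E[n])`;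
* GIVEN Tate's local Euler characteristic count in the form
  `hEuler : #H¹(K_v, E[n]) = (#E(K_v)[n] · #(𝓞_v/n))²` (Milne, *ADT*, I Thm. 2.8 for `M = E[n]`:
  `#H¹ = #H⁰ · #H² · #(𝓞_v/n²𝓞_v)`, with `#H⁰(K_v, E[n]) = #E(K_v)[n]` — tree
  `natCard_galoisCohomology_zero_torsion_restrictField_nat`, file `LocalTorsionInvariants.lean` — and
  `#H²(K_v, E[n]) = #H⁰(K_v, E[n]^D) = #E(K_v)[n]` by local duality in degrees `0, 2` and the Weil
  pairing; Thm. 2.8 and the degree-`2` duality are not yet in the tree, whence a hypothesis):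
  - **`#H¹(K_v, E)[n] = #E(K_v)[n] · #(𝓞_v/n) = #(E(K_v)/nE(K_v))`**
    (`natCard_torsionBy_galoisCohomology_localGaloisModule_eq_of_eulerChar`,
    `…_eq_card_quotient_of_eulerChar`) — the order statement of Tate local duality for `E`,
    Milne, *ADT*, I Thm. 3.2 / Cor. 3.4 (`H¹(K_v, E)[n] ≅ (E(K_v)/n)^*`);
  - **`𝓛_v^⊥ = 𝓛_v`** for the local Weil cup product
    (`forall_mem_kummerLocalConditionAt_weilCupProduct_eq_zero_iff_of_eulerChar` over `K_v`, and
    `forall_mem_kummerSelmerStructure_weilCupProduct_eq_zero_iff_inr_of_eulerChar` at the place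
    `Sum.inr v` of the Kummer Selmer structure) — the local input of Milne I Lemma 6.15 /
    Thm. 6.13(a) (Poonen–Rains 2012, Prop. 4.10).

Motivation: provefact `WeierstrassCurve.exists_casselsTate_pairing` (Silverman *AEC* X.4.14; Milne
*ADT* I.6.13(a)); this pins the interface through which the local Euler characteristic formula, once
in the tree, yields local duality for `E`.

## References

* [MilneADT2006] J. S. Milne, *Arithmetic Duality Theorems*, 2nd ed. (2006), Ch. I: Thm. 2.8,
  Thm. 3.2, Lemma 3.3, Cor. 3.4, §6 (Lemma 6.15).
* [SilvermanAEC2009] J. H. Silverman, *The Arithmetic of Elliptic Curves*, 2nd ed. (2009), X.§4.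
* [PoonenRains2012] B. Poonen, E. Rains, *Random maximal isotropic subspaces and Selmer groups*,
  J. Amer. Math. Soc. 25 (2012), Prop. 4.10.
-/

noncomputable section

open scoped Classical

universe u

namespace Literature.NumberTheory.EllipticCurves

open CategoryTheory _root_.WeierstrassCurve Field Function NumberField IsDedekindDomain
open Literature.NumberTheory.GaloisRepresentations
open Literature.NumberTheory.GaloisRepresentations.DiscreteGaloisModule (mu MuCarrier)
open scoped ContRepresentation

-- Cup products need `LocallyCompactSpace Γ_F`; as in `LocalWeilPairingDuality.lean`, the compactness of
-- absolute Galois groups is a local instance only.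
attribute [local instance] absoluteGaloisGroup_compactSpace

variable {K : Type u} [Field K] [NumberField K] (W : WeierstrassCurve K) [W.IsElliptic]
variable (v : HeightOneSpectrum (𝓞 K))

/-! ## `#H¹(K_v, E)[n] · #𝓛_v = #H¹(K_v, E[n])` with `#𝓛_v = #E(K_v)[n] · #(𝓞_v/n)` -/

/-- **`#H¹(K_v, E)[n] · (#E(K_v)[n] · #(𝓞_v/n)) = #H¹(K_v, E[n])`** at a finite place `v` (`n ≠ 0`):
the order relation of `0 → E(K_v)/n → H¹(K_v, E[n]) → H¹(K_v, E)[n] → 0`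
(`natCard_torsionBy_mul_natCard_kummerLocalConditionAt`) with `#𝓛_v = #E(K_v)[n] · #(𝓞_v/n)`
(`natCard_kummerLocalConditionAt_adicCompletion`, Milne I Lemma 3.3). Unconditional.
[cite: MilneADT2006, I Lemma 3.3] [cite: SilvermanAEC2009, X.§4 diagram (**)] -/
theorem natCard_torsionBy_galoisCohomology_localGaloisModule_mul {n : ℕ} (hn : n ≠ 0) :
    Nat.card (AddSubgroup.torsionBy
          (galoisCohomology (W.localGaloisModule (v.adicCompletion K)) 1) (n : ℤ)) *
        (Nat.card (nsmulAddMonoidHom n :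
            (W.baseChange (v.adicCompletion K)).toAffine.Point →+ _).ker *
          Nat.card (v.adicCompletionIntegers K ⧸
            Ideal.span {(n : v.adicCompletionIntegers K)})) =
      Nat.card (galoisCohomology
        (GaloisRep.restrictField (v.adicCompletion K) (W.torsionGaloisModule n)) 1) := by
  haveI : CharZero (v.adicCompletion K) := charZero_adicCompletion v
  rw [← W.natCard_kummerLocalConditionAt_adicCompletion v hn]
  exact W.natCard_torsionBy_mul_natCard_kummerLocalConditionAt (v.adicCompletion K)
    (Int.natCast_ne_zero.mpr hn)

/-- `#E(K_v)[n] · #(𝓞_v/n) ≠ 0` (both factors are orders of finite non-empty groups). [folklore] -/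
theorem natCard_ker_nsmul_mul_natCard_quotient_ne_zero {n : ℕ} (hn : n ≠ 0) :
    Nat.card (nsmulAddMonoidHom n :
          (W.baseChange (v.adicCompletion K)).toAffine.Point →+ _).ker *
        Nat.card (v.adicCompletionIntegers K ⧸
          Ideal.span {(n : v.adicCompletionIntegers K)}) ≠ 0 := by
  haveI := W.finite_ker_nsmul_adicCompletion v hn
  exact mul_ne_zero Nat.card_pos.ne' (LocalPoints.card_quotient_span_natCast_ne_zero v hn)

/-! ## Consequences of the local Euler characteristic count -/

/-- **Tate local duality for `E`, order form, from the Euler characteristic count**: if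
`#H¹(K_v, E[n]) = (#E(K_v)[n] · #(𝓞_v/n))²` (Tate's local Euler characteristic formula, Milne I
Thm. 2.8 for `M = E[n]`, with `#H⁰ = #H² = #E(K_v)[n]`), then
`#H¹(K_v, E)[n] = #E(K_v)[n] · #(𝓞_v/n)` — Milne, *ADT*, I Thm. 3.2 / Cor. 3.4
(`H¹(K, A)_n` is dual to `A(K)/n`, of order `#A(K)[n] · #(R/nR)` by Lemma 3.3).
[cite: MilneADT2006, I Thm. 3.2 and Lemma 3.3] -/
theorem natCard_torsionBy_galoisCohomology_localGaloisModule_eq_of_eulerChar {n : ℕ} (hn : n ≠ 0)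
    (hEuler : Nat.card (galoisCohomology
        (GaloisRep.restrictField (v.adicCompletion K) (W.torsionGaloisModule n)) 1) =
      (Nat.card (nsmulAddMonoidHom n :
            (W.baseChange (v.adicCompletion K)).toAffine.Point →+ _).ker *
          Nat.card (v.adicCompletionIntegers K ⧸
            Ideal.span {(n : v.adicCompletionIntegers K)})) ^ 2) :
    Nat.card (AddSubgroup.torsionBy
          (galoisCohomology (W.localGaloisModule (v.adicCompletion K)) 1) (n : ℤ)) =
      Nat.card (nsmulAddMonoidHom n :
            (W.baseChange (v.adicCompletion K)).toAffine.Point →+ _).ker *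
        Nat.card (v.adicCompletionIntegers K ⧸
          Ideal.span {(n : v.adicCompletionIntegers K)}) := by
  have h := natCard_torsionBy_galoisCohomology_localGaloisModule_mul W v hn
  rw [hEuler, sq] at h
  exact Nat.eq_of_mul_eq_mul_right
    (Nat.pos_of_ne_zero (natCard_ker_nsmul_mul_natCard_quotient_ne_zero W v hn)) h

/-- The same with the right-hand side written as `#(E(K_v)/nE(K_v))`
(`card_quotient_range_nsmul_adicCompletion`): **`#H¹(K_v, E)[n] = #(E(K_v)/nE(K_v))`**, the order
statement of the perfect pairing `H¹(K_v, E)[n] × E(K_v)/n → ℚ/ℤ` of Tate local duality.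
[cite: MilneADT2006, I Thm. 3.2 and Cor. 3.4] -/
theorem natCard_torsionBy_galoisCohomology_localGaloisModule_eq_card_quotient_of_eulerChar {n : ℕ}
    (hn : n ≠ 0)
    (hEuler : Nat.card (galoisCohomology
        (GaloisRep.restrictField (v.adicCompletion K) (W.torsionGaloisModule n)) 1) =
      (Nat.card (nsmulAddMonoidHom n :
            (W.baseChange (v.adicCompletion K)).toAffine.Point →+ _).ker *
          Nat.card (v.adicCompletionIntegers K ⧸
            Ideal.span {(n : v.adicCompletionIntegers K)})) ^ 2) :
    Nat.card (AddSubgroup.torsionBy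
          (galoisCohomology (W.localGaloisModule (v.adicCompletion K)) 1) (n : ℤ)) =
      Nat.card ((W.baseChange (v.adicCompletion K)).toAffine.Point ⧸
        (nsmulAddMonoidHom n : (W.baseChange (v.adicCompletion K)).toAffine.Point →+ _).range) := by
  rw [natCard_torsionBy_galoisCohomology_localGaloisModule_eq_of_eulerChar W v hn hEuler,
    W.card_quotient_range_nsmul_adicCompletion v hn]

section Weil

variable (n : ℕ) [NeZero n]
variable (e : geomTorsion W n → geomTorsion W n → AlgebraicClosure K)
  (hμ : ∀ S T, e S T ^ n = 1)
  (hadd₁ : ∀ S₁ S₂ T, e (S₁ + S₂) T = e S₁ T * e S₂ T)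
  (hadd₂ : ∀ S T₁ T₂, e S (T₁ + T₂) = e S T₁ * e S T₂)

/-- **`𝓛_v^⊥ = 𝓛_v` from the Euler characteristic count** (over `K_v = v.adicCompletion K`): for a
non-degenerate alternating `Γ_K`-equivariant `μₙ`-valued `e` on `E[n]` (a Weil pairing), if
`#H¹(K_v, E[n]) = (#E(K_v)[n] · #(𝓞_v/n))²` then for `x ∈ H¹(K_v, E[n])`,
`(∀ y ∈ 𝓛_v, x ∪ₑ y = 0) ↔ x ∈ 𝓛_v`
(`forall_mem_kummerLocalConditionAt_weilCupProduct_eq_zero_iff` fed with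
`#𝓛_v = #E(K_v)[n] · #(𝓞_v/n)`). Milne, *ADT*, I Lemma 6.15 (local input) with Cor. 3.4;
Poonen–Rains 2012, Prop. 4.10. [cite: MilneADT2006, Ch. I, Cor. 3.4 and Lemma 6.15]
[cite: PoonenRains2012, Prop. 4.10] -/
theorem forall_mem_kummerLocalConditionAt_weilCupProduct_eq_zero_iff_of_eulerChar
    (hgal : ∀ (σ : absoluteGaloisGroup K) (S T : geomTorsion W n), σ • e S T = e (σ • S) (σ • T))
    (halt : ∀ T, e T T = 1) (hnondeg : ∀ T, (∀ S, e S T = 1) → T = 0)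
    (hEuler : Nat.card (galoisCohomology
        (GaloisRep.restrictField (v.adicCompletion K) (W.torsionGaloisModule n)) 1) =
      (Nat.card (nsmulAddMonoidHom n :
            (W.baseChange (v.adicCompletion K)).toAffine.Point →+ _).ker *
          Nat.card (v.adicCompletionIntegers K ⧸
            Ideal.span {(n : v.adicCompletionIntegers K)})) ^ 2)
    (x : galoisCohomology (GaloisRep.restrictField (v.adicCompletion K) (W.torsionGaloisModule n)) 1) :
    (∀ y ∈ W.kummerLocalConditionAt n (v.adicCompletion K),
        ((weilContPairing W n e hμ hadd₁ hadd₂ hgal).restrict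
          (absGaloisRestrict K (v.adicCompletion K))).cupProduct x y = 0) ↔
      x ∈ W.kummerLocalConditionAt n (v.adicCompletion K) := by
  haveI : CharZero (v.adicCompletion K) := charZero_adicCompletion v
  refine forall_mem_kummerLocalConditionAt_weilCupProduct_eq_zero_iff W n e hμ hadd₁ hadd₂
    (v.adicCompletion K) hgal halt hnondeg ?_ x
  rw [hEuler, sq, W.natCard_kummerLocalConditionAt_adicCompletion v (NeZero.ne n)]

/-- **`𝓛_v^⊥ = 𝓛_v` from the Euler characteristic count, at the place `Sum.inr v` of the Kummer
Selmer structure** (the local condition `W.kummerSelmerStructure n (Sum.inr v)` and the local Weil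
pairing `weilContPairingLocal … (Sum.inr v)` of `WeilPairingTateDual.lean`; `Place.Completion (Sum.inr v)`
is `v.adicCompletion K` definitionally). [cite: MilneADT2006, Ch. I, Cor. 3.4 and Lemma 6.15] -/
theorem forall_mem_kummerSelmerStructure_weilCupProduct_eq_zero_iff_inr_of_eulerChar
    (hgal : ∀ (σ : absoluteGaloisGroup K) (S T : geomTorsion W n), σ • e S T = e (σ • S) (σ • T))
    (halt : ∀ T, e T T = 1) (hnondeg : ∀ T, (∀ S, e S T = 1) → T = 0)
    (hEuler : Nat.card (galoisCohomology ((W.torsionGaloisModule n).toLocal (Sum.inr v)) 1) =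
      (Nat.card (nsmulAddMonoidHom n :
            (W.baseChange (v.adicCompletion K)).toAffine.Point →+ _).ker *
          Nat.card (v.adicCompletionIntegers K ⧸
            Ideal.span {(n : v.adicCompletionIntegers K)})) ^ 2)
    (x : galoisCohomology ((W.torsionGaloisModule n).toLocal (Sum.inr v)) 1) :
    (∀ y ∈ W.kummerSelmerStructure n (Sum.inr v),
        (weilContPairingLocal W n e hμ hadd₁ hadd₂ hgal (Sum.inr v)).cupProduct x y = 0) ↔
      x ∈ W.kummerSelmerStructure n (Sum.inr v) := by
  have h := forall_mem_kummerLocalConditionAt_weilCupProduct_eq_zero_iff_of_eulerChar W v n e hμ hadd₁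
    hadd₂ hgal halt hnondeg
  exact h hEuler x

end Weil

end Literature.NumberTheory.EllipticCurves

end
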